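import Summits.HodgeConjecture.HodgeConjecture.Theses.LinearSystemTorelli
import Literature.AlgebraicGeometry.HodgeTheory.DivisorInduction

/-!
# Route LinearSystemTorelli — `DivisorInduction` (item stmt-HodgeConjecture-1082) modulo Deligne's
# Cor. 8.2.8 and the lifting of Hodge classes along Gysin morphisms

The support item `DivisorInduction` of this route (shared verbatim with route `NodalSupport`): for
`1 ≤ p`, if on every smooth projective `n`-fold every rational `(p−1, p−1)`-class is algebraic, then
on every smooth projective `(n+1)`-fold every rational `(p, p)`-class supported on a divisor
(`∈ supportedClasses X (2p) 1 = N¹H²ᵖ`) is algebraic (`∈ algebraicClasses X p`). The mathematics is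
the Literature theorem `Literature.AlgebraicGeometry.HodgeTheory.divisorInduction_of_deligne_of_hodgeClassLift`
(`HodgeTheory/DivisorInduction`: resolutions of the components of the support padded by projective
spaces to dimension `n`, Deligne's description of the classes dying off the support as Gysin images,
the Hodge-theoretic lift of the rational `(p,p)`-class to rational `(p−1,p−1)`-classes upstairs, the
hypothesis on the `n`-folds, and push-forward of algebraic classes), which is CONDITIONAL exactly on
the tree's two undischarged named facts

* `Literature.AlgebraicGeometry.HodgeTheory.Deligne1974_ker_restrictCompl_eq_iSup_range_complexGysin`
  (Deligne, *Hodge III*, Cor. 8.2.8), and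
* `Literature.AlgebraicGeometry.HodgeTheory.Voisin2025_hodgeClass_lift_complexGysin` (Voisin 2025,
  Cor. 2.12: semisimplicity of polarisable Hodge structures).

This file records the route-side corollary against this route's copy of the decl; it does NOT close
the item (the two facts are hypotheses), and becomes the closing proof verbatim once both facts are
discharged (`…_holds`).
-/

noncomputable section

namespace Summit.HodgeConjecture.HodgeConjecture.Theorems

/-- **Item stmt-HodgeConjecture-1082 (`DivisorInduction`), `LinearSystemTorelli` copy, modulo the two
named facts** `Deligne1974_ker_restrictCompl_eq_iSup_range_complexGysin` (`hA`, Hodge III Cor. 8.2.8)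
and `Voisin2025_hodgeClass_lift_complexGysin` (`hB`, Voisin 2025 Cor. 2.12): the conclusion is
literally the route decl `Summit.HodgeConjecture.HodgeConjecture.Theses.LinearSystemTorelli.DivisorInduction`,
by the Literature theorem `divisorInduction_of_deligne_of_hodgeClassLift`.
[cite: DeligneHodgeIII1974, Cor. 8.2.8] [cite: Voisin2025, Cor. 2.12 (p. 24) and Cor. 4.5 (p. 38)]
[cite: Thomas2005Nodes, §2] -/
theorem linearSystemTorelli_divisorInduction_of_deligne_of_hodgeClassLift
    (hA : Literature.AlgebraicGeometry.HodgeTheory.Deligne1974_ker_restrictCompl_eq_iSup_range_complexGysin)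
    (hB : Literature.AlgebraicGeometry.HodgeTheory.Voisin2025_hodgeClass_lift_complexGysin) :
    Summit.HodgeConjecture.HodgeConjecture.Theses.LinearSystemTorelli.DivisorInduction := by
  unfold Summit.HodgeConjecture.HodgeConjecture.Theses.LinearSystemTorelli.DivisorInduction
  exact Literature.AlgebraicGeometry.HodgeTheory.divisorInduction_of_deligne_of_hodgeClassLift hA hB

end Summit.HodgeConjecture.HodgeConjecture.Theorems

end
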